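import Summits.ResolutionOfSingularities.ResolutionOfSingularities.Theorems.WeightedInvariantKeyRungThreeOfWeightedPresentation
import HarnessLib

/-!
# Gap list of `stub_keyRungGrHomLE_three` SPLIT into its two remaining mathematical statements: the WEIGHTED PRESENTATION of
# `(P, J₃ᵗ)` at the canonical centre, and the WEIGHTED DROP of `ι₃ᵗ` for every such presentation
# (door `HypersurfaceCentreConstruction`, stmt-ResolutionOfSingularities-19897)

Helper for `stub_keyRungGrHomLE_three` (def-free, `--supports 19897`).  Sequel of …KeyRungThreeOfWeightedPresentation (gap list hD, hpres).
hpres = (PRES)₃ ∧ (DROP)₃ where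
* (PRES)₃: at every `S` of the door setting (`dim S ≤ 3`, `0 ≠ f ∈ 𝔪²`) and its canonical centre `P` (prime, `S ⧸ P` regular, `f ∈ P`,
  `topStratum ι₀ S f = V(P)`) there is a regular system of parameters `u` with weights `w` (some positive) such that
  `span {u_i : w_i > 0} = P` and `weightedMonomialIdeal u w m = J₃ᵗ S f m` for all `m` [L; the local form of the landed clause (open″)≤3
  `JOpenPresentationForallSingLE 3 p iotaFlatT jFlatT`, read at the closed point and padded by weight-`0` parameters];
* (DROP)₃: for EVERY such presentation, `WeightedDropHom iotaFlatT S f P u w` — the invariant drops at the `t`-homogeneous points of the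
  weighted blow-up [XL; the characteristic-`p` drop, the substance of the crux].
**`keyRungGrHomLE_three_of_pres_drop`**: `KeyRungGrHomLE 3 p` from hD (typing item), (PRES)₃ and (DROP)₃.
[OURS · L1 W4.3 · audit glue; AI work, weaker than expert review; nothing here is a statement of the manuscript under review.]
-/

noncomputable section

set_option linter.dupNamespace false -- mandated namespace of this single-conjunct summit

open IsLocalRing Literature.AlgebraicGeometry.Resolution
open Summit.ResolutionOfSingularities.ResolutionOfSingularities.Theorems
open Summit.ResolutionOfSingularities.ResolutionOfSingularities.Theorems.ContactCylinder

namespace Summit.ResolutionOfSingularities.ResolutionOfSingularities.Cruxes.HypersurfaceCentreConstruction.LocalEngine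

open Iota3

/-- **GAP LIST OF RECORD for `stub_keyRungGrHomLE_three` — hD, (PRES)₃, (DROP)₃** (see the module docstring). [OURS · L1 W4.3 · audit glue] -/
theorem keyRungGrHomLE_three_of_pres_drop (p : ℕ)
    (hD : ∀ (T T' : Type) [CommRing T] [IsRegularLocalRing T] [CommRing T'] [IsRegularLocalRing T'] [Algebra T T']
      [IsLocalHom (algebraMap T T')] [Algebra.FormallySmooth T T'] [Algebra.EssFiniteType T T'] (g : T),
      ringKrullDim T' ≤ 3 → IsTiePosition T' (algebraMap T T' g) → IsTiePosition T g)
    (hPRES : ∀ (k₀ : Type) [Field k₀] [CharP k₀ p] [PerfectField k₀]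
      (S : Type) [CommRing S] [Algebra k₀ S] [Algebra.EssFiniteType k₀ S] [IsRegularLocalRing S]
      (f : S), ringKrullDim S ≤ 3 → f ≠ 0 → f ∈ (maximalIdeal S) ^ 2 →
      ∀ (P : Ideal S) [P.IsPrime], IsRegularLocalRing (S ⧸ P) → f ∈ P →
        topStratum iotaOrdEpsTau S f = {𝔮 | P ≤ 𝔮.asIdeal} →
        ∃ (n : ℕ) (u : Fin n → S) (w : Fin n → ℕ),
          Ideal.span (Set.range u) = maximalIdeal S ∧ (maximalIdeal S).spanFinrank = n ∧ (∃ i, 0 < w i) ∧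
          Ideal.span {x | ∃ i, 0 < w i ∧ x = u i} = P ∧
          (∀ m : ℕ, weightedMonomialIdeal u w m = jFlatT S f m))
    (hDROP : ∀ (k₀ : Type) [Field k₀] [CharP k₀ p] [PerfectField k₀]
      (S : Type) [CommRing S] [Algebra k₀ S] [Algebra.EssFiniteType k₀ S] [IsRegularLocalRing S]
      (f : S), ringKrullDim S ≤ 3 → f ≠ 0 → f ∈ (maximalIdeal S) ^ 2 →
      ∀ (P : Ideal S) [P.IsPrime], IsRegularLocalRing (S ⧸ P) → f ∈ P →
        topStratum iotaOrdEpsTau S f = {𝔮 | P ≤ 𝔮.asIdeal} →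
        ∀ (n : ℕ) (u : Fin n → S) (w : Fin n → ℕ),
          Ideal.span (Set.range u) = maximalIdeal S → (maximalIdeal S).spanFinrank = n → (∃ i, 0 < w i) →
          Ideal.span {x | ∃ i, 0 < w i ∧ x = u i} = P →
          (∀ m : ℕ, weightedMonomialIdeal u w m = jFlatT S f m) →
          WeightedDropHom iotaFlatT S f P u w) :
    KeyRungGrHomLE 3 p := by
  refine keyRungGrHomLE_three_of_weightedPresentation p hD fun k₀ _ _ _ S _ _ _ _ f hd hf0 hf2 P _ hreg hfP hE => ?_
  obtain ⟨n, u, w, h1, h2, h3, h4, h5⟩ := hPRES k₀ S f hd hf0 hf2 P hreg hfP hE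
  exact ⟨n, u, w, h1, h2, h3, h4, h5, hDROP k₀ S f hd hf0 hf2 P hreg hfP hE n u w h1 h2 h3 h4 h5⟩

end Summit.ResolutionOfSingularities.ResolutionOfSingularities.Cruxes.HypersurfaceCentreConstruction.LocalEngine

end
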